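import Summits.Ventures.LatticeQCDFlow.TrivializingMaps.WilsonVarianceFloorAllCouplings
import Summits.Ventures.LatticeQCDFlow.TrivializingMaps.UNHaarTraceMoments
import Summits.Ventures.LatticeQCDFlow.TrivializingMaps.Z2WilsonFisherZero

/-!
HONEST FRAMING: exact (Metropolis-corrected) sampling algorithms for lattice gauge theory; figures
of merit are autocorrelation/cost numbers at stated couplings and volumes; no continuum-physics
claim.

# WilsonVarianceFloorInstances — `U(1)`, `U(N)`, `ℤ₂`: THE SPECIFIC HEAT PER SITE IS BOUNDED BELOW AT
# EVERY COUPLING UNIFORMLY IN THE VOLUME, AND EVERY FINITE-VOLUME WILSON PARTITION FUNCTION HAS A FISHER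
# ZERO WITHIN A VOLUME-INDEPENDENT DISTANCE OF EVERY REAL COUPLING (lean-2 GEN-9, ours)

Venture-side (OURS).  Cell `lqcd-flow` (pub-lqcd), unit `pub-lqcd-lean-2-g9`, 2026-08-22.  Instances of
`WilsonVarianceFloorAllCouplings` with the Haar variances of the tree (`Var_Haar(Re z) = ½` on `U(1)`,
`U1WilsonFisherZero`; `Var_Haar(Re tr) = ½` on `U(N)`, `UNHaarTraceMoments`; `= 1` on `ℤ₂`,
`Z2WilsonFisherZero`), every `d ≥ 2`, EVERY `L ≥ 2`, EVERY real `β`, `K = (d+1)d²`: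

* **`u1_variance_ge_allCouplings`** / **`u1_exists_fisherZero_near_allCouplings`** —
  `Var_{μ_β}(S_W^{U(1)}) ≥ e^{-2K(1+4K)|β|}·⌊L/2⌋^d/2` and a zero `s₀` of `Z_L` with
  `|s₀ − β| ≤ 8·d²·3^d·e^{2K(1+4K)|β|}`;
* **`un_variance_ge_allCouplings`** / **`un_exists_fisherZero_near_allCouplings`** (`N ≥ 1`) —
  `Var ≥ e^{-2NK(1+4K)|β|}·⌊L/2⌋^d/2`, a zero within `8N·d²·3^d·e^{2NK(1+4K)|β|}`;
* **`z2_variance_ge_allCouplings`** / **`z2_exists_fisherZero_near_allCouplings`** —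
  `Var ≥ e^{-2K(1+4K)|β|}·⌊L/2⌋^d`, a zero within `4·d²·3^d·e^{2K(1+4K)|β|}`.

NOT CLAIMED: `SU(n)` in the tree's ambient-matrix formulation (same proof, different plumbing); sharp
constants; `L = 1`.  Literature grade (cell rule): instances; new typing only.
-/

noncomputable section

open MeasureTheory ProbabilityTheory Filter Topology Set
open Literature.MathematicalPhysics.QuantumFieldTheory
open Literature.MathematicalPhysics.QuantumFieldTheory.Luscher2010
open Literature.MathematicalPhysics.QuantumLattice (u1Rep continuous_u1Rep u1Rep_mem_unitaryGroup z2Rep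
  z2Rep_mem_unitaryGroup unitaryFundamentalRep continuous_unitaryFundamentalRep)

namespace Summit.Ventures.LatticeQCDFlow.TrivializingMaps

variable {d L : ℕ} [NeZero L]

/-! ## `U(1)` -/

section U1

variable [MeasurableSpace Circle] [BorelSpace Circle]

/-- **`U(1)`: `Var_{μ_β}(S_W) ≥ e^{-2K(1+4K)|β|} · ⌊L/2⌋^d / 2` at every real `β`, every `L ≥ 2`, `d ≥ 2`.**
[ours] -/
theorem u1_variance_ge_allCouplings (hd : 2 ≤ d) (hL : 2 ≤ L) (β : ℝ) :
    Real.exp (-(|β| * (2 * ((1 : ℕ) : ℝ) * ((d + 1) * d ^ 2 : ℕ) * (1 + 4 * ((d + 1) * d ^ 2 : ℕ))))) *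
        ((L / 2) ^ d : ℕ) * (1 / 2) ≤
      variance (wilsonAction (d := d) (L := L) u1Rep) (wilsonMeasure (d := d) (L := L) u1Rep β) := by
  have h := wilson_variance_ge_allCouplings (d := d) (L := L) u1Rep hd hL continuous_u1Rep u1Rep_mem_unitaryGroup β
  rwa [variance_re_haar_circle] at h

/-- **`U(1)`: a Fisher zero within `8·d²·3^d·e^{2K(1+4K)|β|}` of every real `β`, in every volume `L ≥ 2`**
(`d ≥ 2`). [ours] -/
theorem u1_exists_fisherZero_near_allCouplings (hd : 2 ≤ d) (hL : 2 ≤ L) (β : ℝ) :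
    ∃ s₀ : ℂ, ‖s₀ - β‖ ≤ 8 * ((d ^ 2 * 3 ^ d : ℕ) : ℝ) *
        Real.exp (|β| * (2 * ((1 : ℕ) : ℝ) * ((d + 1) * d ^ 2 : ℕ) * (1 + 4 * ((d + 1) * d ^ 2 : ℕ)))) ∧
      complexMGF (fun U => -wilsonAction u1Rep U) (trivialMeasure Circle d L) s₀ = 0 := by
  obtain ⟨s₀, hs₀, hz⟩ := wilson_exists_fisherZero_near_allCouplings (d := d) (L := L) u1Rep hd hL
    continuous_u1Rep u1Rep_mem_unitaryGroup (by rw [variance_re_haar_circle]; norm_num) β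
  refine ⟨s₀, hs₀.trans (le_of_eq ?_), hz⟩
  rw [variance_re_haar_circle]
  simp only [Nat.cast_one]
  ring

end U1

/-! ## `U(N)` -/

section UN

variable {N : ℕ}

/-- **`U(N)` (`N ≥ 1`): `Var_{μ_β}(S_W) ≥ e^{-2NK(1+4K)|β|} · ⌊L/2⌋^d / 2` at every real `β`, every
`L ≥ 2`, `d ≥ 2`.** [ours] -/
theorem un_variance_ge_allCouplings (hN : 1 ≤ N) (hd : 2 ≤ d) (hL : 2 ≤ L) (β : ℝ) :
    Real.exp (-(|β| * (2 * N * ((d + 1) * d ^ 2 : ℕ) * (1 + 4 * ((d + 1) * d ^ 2 : ℕ))))) *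
        ((L / 2) ^ d : ℕ) * (1 / 2) ≤
      variance (wilsonAction (d := d) (L := L) (unitaryFundamentalRep (Fin N) ℂ))
        (wilsonMeasure (d := d) (L := L) (unitaryFundamentalRep (Fin N) ℂ) β) := by
  haveI := unitaryGroup_secondCountableTopology (N := N)
  have h := wilson_variance_ge_allCouplings (d := d) (L := L) (unitaryFundamentalRep (Fin N) ℂ) hd hL
    (continuous_unitaryFundamentalRep (Fin N) ℂ) unitaryFundamentalRep_mem_unitaryGroup β
  rwa [un_variance_re_trace hN] at h

/-- **`U(N)` (`N ≥ 1`): a Fisher zero within `8N·d²·3^d·e^{2NK(1+4K)|β|}` of every real `β`, in every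
volume `L ≥ 2`** (`d ≥ 2`). [ours] -/
theorem un_exists_fisherZero_near_allCouplings (hN : 1 ≤ N) (hd : 2 ≤ d) (hL : 2 ≤ L) (β : ℝ) :
    ∃ s₀ : ℂ, ‖s₀ - β‖ ≤ 8 * N * ((d ^ 2 * 3 ^ d : ℕ) : ℝ) *
        Real.exp (|β| * (2 * N * ((d + 1) * d ^ 2 : ℕ) * (1 + 4 * ((d + 1) * d ^ 2 : ℕ)))) ∧
      complexMGF (fun U => -wilsonAction (unitaryFundamentalRep (Fin N) ℂ) U)
        (trivialMeasure (Matrix.unitaryGroup (Fin N) ℂ) d L) s₀ = 0 := by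
  haveI := unitaryGroup_secondCountableTopology (N := N)
  obtain ⟨s₀, hs₀, hz⟩ := wilson_exists_fisherZero_near_allCouplings (d := d) (L := L)
    (unitaryFundamentalRep (Fin N) ℂ) hd hL (continuous_unitaryFundamentalRep (Fin N) ℂ)
    unitaryFundamentalRep_mem_unitaryGroup (by rw [un_variance_re_trace hN]; norm_num) β
  refine ⟨s₀, hs₀.trans (le_of_eq ?_), hz⟩
  rw [un_variance_re_trace hN]
  ring

end UN

/-! ## `ℤ₂` -/

section Z2

variable [MeasurableSpace (Multiplicative (ZMod 2))] [BorelSpace (Multiplicative (ZMod 2))]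

/-- **`ℤ₂`: `Var_{μ_β}(S_W) ≥ e^{-2K(1+4K)|β|} · ⌊L/2⌋^d` at every real `β`, every `L ≥ 2`, `d ≥ 2`.**
[ours] -/
theorem z2_variance_ge_allCouplings (hd : 2 ≤ d) (hL : 2 ≤ L) (β : ℝ) :
    Real.exp (-(|β| * (2 * ((1 : ℕ) : ℝ) * ((d + 1) * d ^ 2 : ℕ) * (1 + 4 * ((d + 1) * d ^ 2 : ℕ))))) *
        ((L / 2) ^ d : ℕ) ≤
      variance (wilsonAction (d := d) (L := L) z2Rep) (wilsonMeasure (d := d) (L := L) z2Rep β) := by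
  have h := wilson_variance_ge_allCouplings (d := d) (L := L) z2Rep hd hL continuous_z2Rep z2Rep_mem_unitaryGroup β
  rwa [z2_variance_re_trace, mul_one] at h

/-- **`ℤ₂`: a Fisher zero within `4·d²·3^d·e^{2K(1+4K)|β|}` of every real `β`, in every volume `L ≥ 2`**
(`d ≥ 2`). [ours] -/
theorem z2_exists_fisherZero_near_allCouplings (hd : 2 ≤ d) (hL : 2 ≤ L) (β : ℝ) :
    ∃ s₀ : ℂ, ‖s₀ - β‖ ≤ 4 * ((d ^ 2 * 3 ^ d : ℕ) : ℝ) *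
        Real.exp (|β| * (2 * ((1 : ℕ) : ℝ) * ((d + 1) * d ^ 2 : ℕ) * (1 + 4 * ((d + 1) * d ^ 2 : ℕ)))) ∧
      complexMGF (fun U => -wilsonAction z2Rep U) (trivialMeasure (Multiplicative (ZMod 2)) d L) s₀ = 0 := by
  obtain ⟨s₀, hs₀, hz⟩ := wilson_exists_fisherZero_near_allCouplings (d := d) (L := L) z2Rep hd hL
    continuous_z2Rep z2Rep_mem_unitaryGroup (by rw [z2_variance_re_trace]; norm_num) β
  refine ⟨s₀, hs₀.trans (le_of_eq ?_), hz⟩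
  rw [z2_variance_re_trace]
  simp only [Nat.cast_one]
  ring

end Z2

end Summit.Ventures.LatticeQCDFlow.TrivializingMaps
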